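import Summits.QuantumFields.YangMills.Theorems.BackwardLiouvilleRigidityHeightwiseRealisation
import Summits.QuantumFields.YangMills.Theorems.FluctuationComparisonRegPrIntLRunPairOrganFiniteChain
import Summits.QuantumFields.YangMills.Theorems.FluctuationComparisonRegPrIntLRunPairOrganInnerWindowChains
import Summits.QuantumFields.YangMills.Theorems.FluctuationComparisonRegPrIntLRunPairOrganWindowTV
import Summits.QuantumFields.YangMills.Theorems.FluctuationComparisonRegPrIntLRunPairOrganIntegralOfTV
import Summits.QuantumFields.YangMills.Theorems.FluctuationComparisonRegPrIntLRunPairOrganRunWindowTailsOfFirstExit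
import Literature.MathematicalPhysics.QuantumFieldTheory.Balaban1983to89.T3MinimiserStabilityReduction
import Literature.MathematicalPhysics.QuantumFieldTheory.Balaban1983to89.T3PrintedRegularMinimiser
import HarnessLib

/-!
# R3 PATH B (run-pair organ) — FILE P-B2: THE RUNG LEAF FROM THE ORGAN ROWS, IN `Theorems/` — per-block-size Cauchy estimate for the unit laws + the refinement trick (★★OWNER WORDS 91∕93, RECORD 17bm)

Width seat `ym-ust-19936-w3` (gen 20), «MINE P-B2» (03:46:48Z).  A VERBATIM PORT into `Theorems/` of the kernel-checked composition of the run-pair organ workfile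
`Cruxes/FluctuationComparisonRegPrIntL/Lines/runpair_organ.lean` (ideator ym-r3-idea-1 g14–g17, v15 0650791df513275d): its `integral_comp_unitA_nestedLaw` (:664–:694) and
`unitLawCauchy_perL_of` (:697–:892), with the organ's Props replaced by (i) their texts VERBATIM as displayed binders — S1a `RunClassMembership` (:111–:127) and S2 `RunPairSeed`
(:145–:175, v15) —, and (ii) the LANDED `Theorems/` copies BY NAME — `RunWindowTailsDoor.RunWindowTailsL` (per-`L` S1b, byte-identical to the organ's v10 S1b),
`RunPairOrgan.BackwardStabilityFinSup` (S3-sup), `RunPairOrgan.InnerWindowChains` (S4a), `RunPairOrgan.WindowTV` (S4b), `RunPairOrgan.IntegralOfTV` (S4c).  §3 feeds it with the 26243 door ✓`runWindowTailsL_of_firstExitWindowTailL`, ✓`finiteChain_sup` (O1 ⇒ S3-sup) and the three landed S4 stubs, and reaches the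
rung leaf by the refinement trick (`yM3TorusSU2_of`, :893–:921, VERBATIM) ⇒ ★★★ `ym3TorusSU2_of_runPairOrganRowsSeed (hS1a) (h26243) (hS2) (hO1) : …YM3TorusSU2`;
the S2-stage glue (S2α′ ∧ S2β ⇒ S2) is px21 g12's P-B1, after which a ten-line follow-up gives the five-row form `(hS1a) (h26243) (hS2α′) (hS2β) (hO1)`.
HONEST: a port of bookkeeping; it proves NO organ row (S1a, S2, S3-sup are DISPLAYED hypotheses here; S1b∕S4· enter by their landed `Theorems/` names); nothing of
[Balaban1985UV3] or of the R3 leaf is proved; rung R3 = SU(2) YM₃ on T³ — NOT d = 4, NOT infinite volume, NOT a mass gap, NOT Clay.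
-/

set_option autoImplicit false

noncomputable section

namespace Summit.QuantumFields.YangMills.Theorems.FluctuationComparisonRegPrIntL.RunPairOrganRung

open MeasureTheory Filter Topology
open Literature.MathematicalPhysics.QuantumFieldTheory.Balaban1983to89 T3ContinuumYM3Torus T3NestedUnitLaws
  T3UnitLawDensityEML T4Continuum BalabanUVClass T3UnitScaleTilt T3PrintedRegularMinimiser
open Summit.QuantumFields.YangMills.Theorems.FluctuationComparisonRegPrIntL.RunPairOrgan
open Summit.QuantumFields.YangMills.Theorems.FluctuationComparisonRegPrIntL.RunPairOrgan.RunWindowTailsDoor (RunWindowTailsL runWindowTailsL_of_firstExitWindowTailL)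

/-! ## §1 The unit law read at any height of the nested laws (port of :664–:694) -/

/-- v10 · THE UNIT LAW OF RUN `K` READ AT ANY HEIGHT `j ≤ K` OF ITS NESTED LAWS: `∫ g dμ_K = ∫ g ∘ A_j dν_{K,j}` for every
measurable `g` on unit fields (`A_j = unitShift ∘ avg^j`; downward induction on the height by `nest` = `unitShift_iter_descend`,
[Balaban1987RG1] (0.11); the loop-product case is the tree's `integral_prod_avgObs_nestedLaw`). -/
theorem integral_comp_unitA_nestedLaw (F : T3Family) {γ : ℝ}
    (ν : ℕ → (j : ℕ) → Measure (GaugeField (F.P j) 0 (Matrix.specialUnitaryGroup (Fin 2) ℂ)))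
    (h1 : ∀ K, ν K K = T4GenFunBounds.gibbsMeasure (F.P K) ((F.scheme ℰp γ).β K))
    (h2 : ∀ K j, j < K → ν K j = Measure.map (descend F ℰp j) (ν K (j + 1)))
    {g : GaugeField (F.P 0) 0 (Matrix.specialUnitaryGroup (Fin 2) ℂ) → ℝ} (hg : Measurable g) (K : ℕ) :
    ∀ j, j ≤ K → ∫ u, g (Literature.MathematicalPhysics.QuantumFieldTheory.Balaban1983to89.T3LevelShift.unitShift F j (Averaging.iter (fun i => BlockAveraging.blockAvg (P := F.P j) (j := i) ℰp) j u)) ∂(ν K j) =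
      ∫ u, g u ∂(F.unitLaw ℰp measurableE_ℰp γ K) := by
  have hmeas : ∀ j, Measurable fun u : GaugeField (F.P j) 0 (Matrix.specialUnitaryGroup (Fin 2) ℂ) => g (Literature.MathematicalPhysics.QuantumFieldTheory.Balaban1983to89.T3LevelShift.unitShift F j (Averaging.iter (fun i => BlockAveraging.blockAvg (P := F.P j) (j := i) ℰp) j u)) := fun j =>
    hg.comp ((Literature.MathematicalPhysics.QuantumFieldTheory.Balaban1983to89.T3LevelShift.measurable_unitShift F j).comp
      (Literature.MathematicalPhysics.QuantumFieldTheory.Balaban1983to89.T4Continuum.measurable_iter _ (F.avgMeasurable_of_measurableE ℰp measurableE_ℰp j) j))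
  rw [Literature.MathematicalPhysics.QuantumFieldTheory.Balaban1983to89.T3ThresholdRemoval.integral_unitLaw measurableE_ℰp K hg]
  suffices h : ∀ d j, j + d = K → ∫ u, g (Literature.MathematicalPhysics.QuantumFieldTheory.Balaban1983to89.T3LevelShift.unitShift F j (Averaging.iter (fun i => BlockAveraging.blockAvg (P := F.P j) (j := i) ℰp) j u)) ∂(ν K j) =
      ∫ u, g (Literature.MathematicalPhysics.QuantumFieldTheory.Balaban1983to89.T3LevelShift.unitShift F K (Averaging.iter (fun i => BlockAveraging.blockAvg (P := F.P K) (j := i) ℰp) K u)) ∂T4GenFunBounds.gibbsMeasure (F.P K) ((F.scheme ℰp γ).β K) from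
    fun j hj => h (K - j) j (by omega)
  intro d
  induction d with
  | zero =>
    intro j hj
    rw [add_zero] at hj
    subst hj
    rw [h1]
  | succ d ih =>
    intro j hj
    rw [h2 K j (by omega), integral_map (measurable_descend F ℰp measurableE_ℰp j).aemeasurable (hmeas j).aestronglyMeasurable,
      ← ih (j + 1) (by omega)]
    refine integral_congr_ae (Eventually.of_forall fun u => ?_)
    show g (Literature.MathematicalPhysics.QuantumFieldTheory.Balaban1983to89.T3LevelShift.unitShift F j (Averaging.iter (fun i => BlockAveraging.blockAvg (P := F.P j) (j := i) ℰp) j (descend F ℰp j u))) = _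
    rw [unitShift_iter_descend]

/-! ## §2 The per-block-size Cauchy estimate from the organ rows (port of :697–:892; S1a and S2 as displayed texts, S1b∕S3-sup∕S4· by their `Theorems/` names) -/

/-- ★★ **PER-BLOCK-SIZE CAUCHY ESTIMATE FOR THE UNIT LAWS FROM THE RUN-PAIR ORGAN ROWS** (bounded measurable observables): the organ workfile's `unitLawCauchy_perL_of` VERBATIM,
over S1a (`h1a`, the text of `RunClassMembership`), S1b per block size (`h1b : RunWindowTailsL`), the seed S2 (`h2`, the text of `RunPairSeed` v15), S3-sup (`h3 : BackwardStabilityFinSup`)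
and S4a–c.  CONDITIONAL — nothing of the rows is proved here. [cite: Balaban1985UV3, (7) p.257, (41) p.266 and (71) p.273; Balaban1987RG1, (0.11) p.253] -/
theorem unitLawCauchy_perL_of_rows
    (h1a : ∀ (L : ℕ), ∃ pm : ℝ, 0 < pm ∧ ∀ (p₀ : ℝ), pm ≤ p₀ → ∃ b₀ : ℝ, 0 < b₀ ∧ ∃ γ₁ : ℝ, 0 < γ₁ ∧ ∀ (F : T3Family) (γ : ℝ), F.L = L → 0 < γ → γ ≤ γ₁ →
      ∃ (j₀ : ℕ) (prm : ℕ → ClassParams), AdmissibleClassParams F γ b₀ p₀ prm ∧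
      ∀ (ν : ℕ → (j : ℕ) → Measure (GaugeField (F.P j) 0 (Matrix.specialUnitaryGroup (Fin 2) ℂ))),
      (∀ K, ν K K = T4GenFunBounds.gibbsMeasure (F.P K) ((F.scheme ℰp γ).β K)) →
      (∀ K j, j < K → ν K j = Measure.map (descend F ℰp j) (ν K (j + 1))) →
      ∃ ρ : ℕ → (j : ℕ) → GaugeField (F.P j) 0 (Matrix.specialUnitaryGroup (Fin 2) ℂ) → ℝ,
      ∀ (K j : ℕ) (hjK : j ≤ K), j₀ ≤ j →
      (∀ U, PlaqSmall (θBal F.L γ b₀ p₀ j) U → 0 < ρ K j U) ∧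
      ν K j = (fieldMeasure _ _ _).withDensity (fun U => ENNReal.ofReal (ρ K j U)) ∧
      MemOfRun F ℰp hjK (prm j) (ρ K j) ∧
      ContinuousOn (ρ K j) {U | PlaqSmall (θBal F.L γ b₀ p₀ j) U})
    (h1b : RunWindowTailsL)
    (h2 : ∀ (L : ℕ), ∃ pS : ℝ, ∀ (b₀ p₀ : ℝ), 0 < b₀ → pS ≤ p₀ → 0 < p₀ → ∃ γ₁ : ℝ, 0 < γ₁ ∧ ∃ κ : ℝ, 0 < κ ∧ ∀ (F : T3Family) (γ : ℝ), F.L = L → 0 < γ → γ ≤ γ₁ →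
      ∃ (J : ℕ → ℕ) (σ : ℕ → ℝ), (∀ K, 1 ≤ K → J K < K) ∧ (∀ K, J K ≤ K) ∧ Tendsto J atTop atTop ∧ (∀ K, 0 ≤ σ K) ∧
      Tendsto σ atTop (𝓝 0) ∧
      Tendsto (fun K => (J K : ℝ) * σ K) atTop (𝓝 0) ∧
      ∀ (ν : ℕ → (j : ℕ) → Measure (GaugeField (F.P j) 0 (Matrix.specialUnitaryGroup (Fin 2) ℂ))),
      (∀ K, ν K K = T4GenFunBounds.gibbsMeasure (F.P K) ((F.scheme ℰp γ).β K)) →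
      (∀ K j, j < K → ν K j = Measure.map (descend F ℰp j) (ν K (j + 1))) →
      ∀ (K K' : ℕ), K ≤ K' → ∀ (ρ₁ ρ₂ : GaugeField (F.P (J K)) 0 (Matrix.specialUnitaryGroup (Fin 2) ℂ) → ℝ),
      (∀ U, PlaqSmall (θBal F.L γ b₀ p₀ (J K)) U → 0 < ρ₁ U ∧ 0 < ρ₂ U) →
      ν K (J K) = (fieldMeasure _ _ _).withDensity (fun U => ENNReal.ofReal (ρ₁ U)) →
      ν K' (J K) = (fieldMeasure _ _ _).withDensity (fun U => ENNReal.ofReal (ρ₂ U)) →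
      ContinuousOn ρ₁ {U | PlaqSmall (θBal F.L γ b₀ p₀ (J K)) U} →
      ContinuousOn ρ₂ {U | PlaqSmall (θBal F.L γ b₀ p₀ (J K)) U} →
      ∀ (b b' : PBond (F.P (J K)) 0) (U V W Z : GaugeField (F.P (J K)) 0 (Matrix.specialUnitaryGroup (Fin 2) ℂ)),
      PlaqSmall (θBal F.L γ b₀ p₀ (J K)) U → PlaqSmall (θBal F.L γ b₀ p₀ (J K)) V →
      PlaqSmall (θBal F.L γ b₀ p₀ (J K)) W → PlaqSmall (θBal F.L γ b₀ p₀ (J K)) Z →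
      (∀ e, e ≠ b → U e = V e) → (∀ e, e ≠ b' → U e = W e) → (∀ e, e ≠ b' → V e = Z e) → (∀ e, e ≠ b → W e = Z e) →
      |(Real.log (ρ₁ U) - Real.log (ρ₂ U)) - (Real.log (ρ₁ V) - Real.log (ρ₂ V)) -
      ((Real.log (ρ₁ W) - Real.log (ρ₂ W)) - (Real.log (ρ₁ Z) - Real.log (ρ₂ Z)))|
      ≤ σ K * Real.exp (-(κ * (b.src.tdist b'.src : ℝ))))
    (h3 : BackwardStabilityFinSup)
    (h4a : InnerWindowChains) (h4b : WindowTV) (h4c : IntegralOfTV) (L : ℕ) :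
    ∃ γ₁ : ℝ, 0 < γ₁ ∧ ∀ (F : T3Family) (γ : ℝ), F.L = L → 0 < γ → γ ≤ γ₁ →
    ∀ (g : GaugeField (F.P 0) 0 (Matrix.specialUnitaryGroup (Fin 2) ℂ) → ℝ), Measurable g → (∀ u, |g u| ≤ 1) →
      CauchySeq (fun K => ∫ u, g u ∂(F.unitLaw ℰp measurableE_ℰp γ K)) := by
  classical
  obtain ⟨pm, hpm, H1a⟩ := h1a L
  obtain ⟨pW, HW⟩ := h4a
  obtain ⟨pT, hpT, h1b⟩ := h1b
  obtain ⟨γe, hγe, H3⟩ := h3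
  obtain ⟨pS, h2L⟩ := h2 L
  have hpm₀ : pm ≤ max pm (max pW (max 1 (max (2 * pT) pS))) := le_max_left _ _
  have hpW₀ : pW ≤ max pm (max pW (max 1 (max (2 * pT) pS))) := (le_max_left _ _).trans (le_max_right _ _)
  have h1le : (1 : ℝ) ≤ max pm (max pW (max 1 (max (2 * pT) pS))) := (le_max_left _ _).trans ((le_max_right _ _).trans (le_max_right _ _))
  have h2pT : 2 * pT ≤ max pm (max pW (max 1 (max (2 * pT) pS))) :=
    (le_max_left _ _).trans ((le_max_right _ _).trans ((le_max_right _ _).trans (le_max_right _ _)))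
  have hpS₀ : pS ≤ max pm (max pW (max 1 (max (2 * pT) pS))) :=
    (le_max_right _ _).trans ((le_max_right _ _).trans ((le_max_right _ _).trans (le_max_right _ _)))
  have hp₀ : 0 < max pm (max pW (max 1 (max (2 * pT) pS))) := lt_of_lt_of_le one_pos h1le
  have hpT₀ : pT ≤ max pm (max pW (max 1 (max (2 * pT) pS))) := by linarith
  have hpT2 : pT ≤ max pm (max pW (max 1 (max (2 * pT) pS))) / 2 := by linarith
  obtain ⟨b₀, hb₀, γa, hγa, H1a⟩ := H1a (max pm (max pW (max 1 (max (2 * pT) pS)))) hpm₀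
  have hsb₀ : 0 < Real.sqrt b₀ := Real.sqrt_pos.mpr hb₀
  have hp₀2 : 0 < max pm (max pW (max 1 (max (2 * pT) pS))) / 2 := by positivity
  obtain ⟨γb, hγb, H1b⟩ := h1b L b₀ (max pm (max pW (max 1 (max (2 * pT) pS)))) hb₀ hpT₀
  obtain ⟨γc, hγc, H1c⟩ := h1b L (Real.sqrt b₀) (max pm (max pW (max 1 (max (2 * pT) pS))) / 2) hsb₀ hpT2
  obtain ⟨γd, hγd, κ, hκ, H2⟩ := h2L b₀ (max pm (max pW (max 1 (max (2 * pT) pS)))) hb₀ hpS₀ hp₀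
  refine ⟨min (min (min γa γb) (min γc γd)) (min γe 1), by positivity, ?_⟩
  intro F γ hFL hγ hle g hg hgb
  have hγa' : γ ≤ γa := hle.trans ((min_le_left _ _).trans ((min_le_left _ _).trans (min_le_left _ _)))
  have hγb' : γ ≤ γb := hle.trans ((min_le_left _ _).trans ((min_le_left _ _).trans (min_le_right _ _)))
  have hγc' : γ ≤ γc := hle.trans ((min_le_left _ _).trans ((min_le_right _ _).trans (min_le_left _ _)))
  have hγd' : γ ≤ γd := hle.trans ((min_le_left _ _).trans ((min_le_right _ _).trans (min_le_right _ _)))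
  have hγe' : γ ≤ γe := hle.trans ((min_le_right _ _).trans (min_le_left _ _))
  have hγ1 : γ ≤ 1 := hle.trans ((min_le_right _ _).trans (min_le_right _ _))
  -- nested laws of the runs and the data delivered by S1a, S1b (outer and inner profile), S2, S3, S4a
  obtain ⟨ν, hν1, hν2, hν3⟩ :=
    Summit.QuantumFields.YangMills.Theorems.BackwardLiouvilleRigidityHeightwiseRealisation.exists_nestedLaws F hγ.le
  obtain ⟨j₀, prm, hadm, Hρ⟩ := H1a F γ hFL hγ hγa'
  obtain ⟨ρ, hρ⟩ := Hρ ν hν1 hν2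
  obtain ⟨η, hη0, hηs, hηs2, hηt, Hη⟩ := H1b F γ hFL hγ hγb'
  have Hη := Hη ν hν1 hν2
  obtain ⟨η', hη'0, hη's, -, -, Hη'⟩ := H1c F γ hFL hγ hγc'
  have Hη' := Hη' ν hν1 hν2
  obtain ⟨J, σ, hJlt, hJle, hJ, hσ0, hσ, hJσ, Hs⟩ := H2 F γ hFL hγ hγd'
  have Hs := Hs ν hν1 hν2
  obtain ⟨θ, C, w₀, ε, δ, j₁, hθ, hC, hw₀, hεδ, hεs, hδs, hDs, hD0, hj₀₁, Horg⟩ :=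
    H3 F γ hγ hγe' b₀ (max pm (max pW (max 1 (max (2 * pT) pS)))) κ j₀ prm η hb₀ hp₀ hadm hκ hη0 hηs hηs2 hηt
  obtain ⟨jW, HWj⟩ := HW (max pm (max pW (max 1 (max (2 * pT) pS)))) hpW₀ F γ b₀ hγ hγ1 hb₀
  -- positivity facts
  have hEpos : 0 < Real.exp (∑' k, ε k + 1) := Real.exp_pos _
  have hDt0 : ∀ j, 0 ≤ ∑' k, δ (k + j) := fun j => tsum_nonneg fun k => (hεδ _).2
  have ha0 : ∀ j : ℕ, 0 ≤ 2 * ((F.L : ℝ) ^ j / γ) * (Fintype.card (PBond (F.P j) 0) : ℝ) := fun j => by positivity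
  have hX0 : ∀ j : ℕ, 0 < 1 / θ + 2 * ((F.L : ℝ) ^ j / γ) * (Fintype.card (Plaq (F.P j) 0) : ℝ) := fun j => by positivity
  -- the three sequences that tend to zero in the height j
  have hDt_lim : Tendsto (fun j => ∑' k, δ (k + j)) atTop (𝓝 0) := tendsto_sum_nat_add δ
  have hDD_lim : Tendsto (fun j => ∑' i, ∑' k, δ (k + (i + j))) atTop (𝓝 0) :=
    tendsto_sum_nat_add (fun i => ∑' k, δ (k + i))
  have hfl_lim : Tendsto (fun j => (∑' k, δ (k + j)) * (1 / θ + 2 * ((F.L : ℝ) ^ j / γ) * (Fintype.card (Plaq (F.P j) 0) : ℝ)) *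
      (Fintype.card (PBond (F.P j) 0) : ℝ) ^ 2) atTop (𝓝 0) := by
    have hM1 : 1 / θ ≤ max (1 / θ) 1 := le_max_left _ _
    have hM2 : (1 : ℝ) ≤ max (1 / θ) 1 := le_max_right _ _
    have hg := hD0.const_mul (max (1 / θ) 1)
    rw [mul_zero] at hg
    refine squeeze_zero (fun j => ?_) (fun j => ?_) hg
    · exact mul_nonneg (mul_nonneg (hDt0 j) (hX0 j).le) (by positivity)
    · have hX : 1 / θ + 2 * ((F.L : ℝ) ^ j / γ) * (Fintype.card (Plaq (F.P j) 0) : ℝ) ≤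
          max (1 / θ) 1 * (1 + 2 * ((F.L : ℝ) ^ j / γ) * (Fintype.card (Plaq (F.P j) 0) : ℝ)) := by
        have h2 : 2 * ((F.L : ℝ) ^ j / γ) * (Fintype.card (Plaq (F.P j) 0) : ℝ) ≤
            max (1 / θ) 1 * (2 * ((F.L : ℝ) ^ j / γ) * (Fintype.card (Plaq (F.P j) 0) : ℝ)) :=
          le_mul_of_one_le_left (by positivity) hM2
        nlinarith
      calc (∑' k, δ (k + j)) * (1 / θ + 2 * ((F.L : ℝ) ^ j / γ) * (Fintype.card (Plaq (F.P j) 0) : ℝ)) *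
            (Fintype.card (PBond (F.P j) 0) : ℝ) ^ 2
          ≤ (∑' k, δ (k + j)) * (max (1 / θ) 1 * (1 + 2 * ((F.L : ℝ) ^ j / γ) * (Fintype.card (Plaq (F.P j) 0) : ℝ))) *
            (Fintype.card (PBond (F.P j) 0) : ℝ) ^ 2 := by
            gcongr
            exact hDt0 j
        _ = max (1 / θ) 1 * ((∑' k, δ (k + j)) * ((1 + 2 * ((F.L : ℝ) ^ j / γ) * (Fintype.card (Plaq (F.P j) 0) : ℝ)) *
            (Fintype.card (PBond (F.P j) 0) : ℝ) ^ 2)) := by ring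
  have hη'_lim : Tendsto η' atTop (𝓝 0) := hη's.tendsto_atTop_zero
  -- the unit-scale expectations form a Cauchy sequence
  rw [Metric.cauchySeq_iff']
  intro t ht
  obtain ⟨δ₀, hδ₀, HTV⟩ := h4b (t / 8) (by positivity)
  -- choice of the height j
  have evj : ∀ᶠ j : ℕ in atTop, max (max j₀ j₁) jW ≤ j ∧ Real.exp (∑' k, ε k + 1) * (∑' k, δ (k + j)) ≤ w₀ / 2 ∧
      C * (Real.exp (∑' k, ε k + 1) * (∑' i, ∑' k, δ (k + (i + j)))) ≤ 1 / 2 ∧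
      Real.exp (∑' k, ε k + 1) * ((∑' k, δ (k + j)) * (1 / θ + 2 * ((F.L : ℝ) ^ j / γ) * (Fintype.card (Plaq (F.P j) 0) : ℝ)) *
        (Fintype.card (PBond (F.P j) 0) : ℝ) ^ 2) ≤ δ₀ / 2 ∧ η' j ≤ δ₀ := by
    have e1 : ∀ᶠ j : ℕ in atTop, Real.exp (∑' k, ε k + 1) * (∑' k, δ (k + j)) ≤ w₀ / 2 := by
      have h := hDt_lim.const_mul (Real.exp (∑' k, ε k + 1))
      rw [mul_zero] at h
      exact h.eventually (ge_mem_nhds (by positivity))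
    have e2 : ∀ᶠ j : ℕ in atTop, C * (Real.exp (∑' k, ε k + 1) * (∑' i, ∑' k, δ (k + (i + j)))) ≤ 1 / 2 := by
      have h := (hDD_lim.const_mul (Real.exp (∑' k, ε k + 1))).const_mul C
      simp only [mul_zero] at h
      exact h.eventually (ge_mem_nhds (by norm_num))
    have e3 : ∀ᶠ j : ℕ in atTop, Real.exp (∑' k, ε k + 1) * ((∑' k, δ (k + j)) *
        (1 / θ + 2 * ((F.L : ℝ) ^ j / γ) * (Fintype.card (Plaq (F.P j) 0) : ℝ)) * (Fintype.card (PBond (F.P j) 0) : ℝ) ^ 2) ≤ δ₀ / 2 := by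
      have h := hfl_lim.const_mul (Real.exp (∑' k, ε k + 1))
      rw [mul_zero] at h
      exact h.eventually (ge_mem_nhds (by positivity))
    have e4 : ∀ᶠ j : ℕ in atTop, η' j ≤ δ₀ := hη'_lim.eventually (ge_mem_nhds hδ₀)
    exact (eventually_ge_atTop _).and (e1.and (e2.and (e3.and e4)))
  obtain ⟨j, hjmax, hjw, hjC, hjτ, hjη⟩ := evj.exists
  have hj₀ : j₀ ≤ j := ((le_max_left _ _).trans (le_max_left _ _)).trans hjmax
  have hj₁ : j₁ ≤ j := ((le_max_right _ _).trans (le_max_left _ _)).trans hjmax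
  have hjW : jW ≤ j := (le_max_right _ _).trans hjmax
  -- choice of the first cut-off K₀
  have evK : ∀ᶠ K : ℕ in atTop, j ≤ J K ∧ Real.exp (∑' k, ε k + 1) * (θ * σ K) ≤ w₀ / 2 ∧
      C * (Real.exp (∑' k, ε k + 1) * (θ * ((J K : ℝ) * σ K))) ≤ 1 / 2 ∧
      Real.exp (∑' k, ε k + 1) * (θ * σ K) * (1 / θ + 2 * ((F.L : ℝ) ^ j / γ) * (Fintype.card (Plaq (F.P j) 0) : ℝ)) *
        (Fintype.card (PBond (F.P j) 0) : ℝ) ^ 2 ≤ δ₀ / 2 := by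
    have e1 : ∀ᶠ K : ℕ in atTop, Real.exp (∑' k, ε k + 1) * (θ * σ K) ≤ w₀ / 2 := by
      have h := (hσ.const_mul θ).const_mul (Real.exp (∑' k, ε k + 1))
      simp only [mul_zero] at h
      exact h.eventually (ge_mem_nhds (by positivity))
    have e2 : ∀ᶠ K : ℕ in atTop, C * (Real.exp (∑' k, ε k + 1) * (θ * ((J K : ℝ) * σ K))) ≤ 1 / 2 := by
      have h := ((hJσ.const_mul θ).const_mul (Real.exp (∑' k, ε k + 1))).const_mul C
      simp only [mul_zero] at h
      exact h.eventually (ge_mem_nhds (by norm_num))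
    have e3 : ∀ᶠ K : ℕ in atTop, Real.exp (∑' k, ε k + 1) * (θ * σ K) *
        (1 / θ + 2 * ((F.L : ℝ) ^ j / γ) * (Fintype.card (Plaq (F.P j) 0) : ℝ)) * (Fintype.card (PBond (F.P j) 0) : ℝ) ^ 2 ≤ δ₀ / 2 := by
      have h := ((((hσ.const_mul θ).const_mul (Real.exp (∑' k, ε k + 1))).mul_const
        (1 / θ + 2 * ((F.L : ℝ) ^ j / γ) * (Fintype.card (Plaq (F.P j) 0) : ℝ))).mul_const
        ((Fintype.card (PBond (F.P j) 0) : ℝ) ^ 2))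
      simp only [mul_zero, zero_mul] at h
      exact h.eventually (ge_mem_nhds (by positivity))
    exact (hJ.eventually (eventually_ge_atTop j)).and (e1.and (e2.and e3))
  obtain ⟨K₀, HK₀⟩ := eventually_atTop.mp (evK.and (eventually_ge_atTop 1))
  refine ⟨K₀, fun K' hK' => ?_⟩
  obtain ⟨⟨hjJ, hKw, hKC, hKτ⟩, hK₀1⟩ := HK₀ K₀ le_rfl
  have hTKlt : J K₀ < K₀ := hJlt K₀ hK₀1
  have hTK : J K₀ ≤ K₀ := hTKlt.le
  have hTK' : J K₀ ≤ K' := hTK.trans hK'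
  have hjK : j ≤ K₀ := hjJ.trans hTK
  have hjK' : j ≤ K' := hjK.trans hK'
  -- the organ, seeded at height J K₀ by S2, run down to height j
  have hw : Real.exp (∑' k, ε k + 1) * (θ * σ K₀ + (∑' k, δ (k + j))) ≤ w₀ := by rw [mul_add]; linarith
  have hCc : C * (Real.exp (∑' k, ε k + 1) * (((J K₀ : ℕ) : ℝ) * (θ * σ K₀) + (∑' i, ∑' k, δ (k + (i + j))))) ≤ 1 := by
    have : C * (Real.exp (∑' k, ε k + 1) * (((J K₀ : ℕ) : ℝ) * (θ * σ K₀) + (∑' i, ∑' k, δ (k + (i + j))))) =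
        C * (Real.exp (∑' k, ε k + 1) * (θ * ((J K₀ : ℝ) * σ K₀))) +
        C * (Real.exp (∑' k, ε k + 1) * (∑' i, ∑' k, δ (k + (i + j)))) := by ring
    linarith
  have hosc := Horg (J K₀) K₀ (σ K₀) hTKlt (hσ0 K₀) (ν K₀) (ν K') (ρ K₀) (ρ K')
    (fun i _ => ⟨hν3 K₀ i, hν3 K' i⟩)
    (fun i hi => ⟨hν2 K₀ i hi, hν2 K' i (lt_of_lt_of_le hi hK')⟩)
    (fun i hi hiT => by
      obtain ⟨p1, w1, m1, c1⟩ := hρ K₀ i hiT hi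
      obtain ⟨p2, w2, m2, c2⟩ := hρ K' i (hiT.trans hK') hi
      exact ⟨fun U hU => ⟨p1 U hU, p2 U hU⟩, w1, w2, ⟨K₀, hiT, m1⟩, ⟨K', hiT.trans hK', m2⟩,
        Hη K₀ i hiT, Hη K' i (hiT.trans hK'), c1, c2⟩)
    (by
      obtain ⟨p1, w1, m1, c1⟩ := hρ K₀ (J K₀) hTK (hj₀.trans hjJ)
      obtain ⟨p2, w2, m2, c2⟩ := hρ K' (J K₀) hTK' (hj₀.trans hjJ)
      exact Hs K₀ K' hK' (ρ K₀ (J K₀)) (ρ K' (J K₀)) (fun U hU => ⟨p1 U hU, p2 U hU⟩) w1 w2 c1 c2)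
    j hj₁ hjJ hw hCc
  -- termination at height j
  have hτ0 : 0 ≤ Real.exp (∑' k, ε k + 1) * (θ * σ K₀ + (∑' k, δ (k + j))) *
      (1 / θ + 2 * ((F.L : ℝ) ^ j / γ) * (Fintype.card (Plaq (F.P j) 0) : ℝ)) :=
    mul_nonneg (mul_nonneg hEpos.le (add_nonneg (mul_nonneg hθ.le (hσ0 K₀)) (hDt0 j))) (hX0 j).le
  have hτD : Real.exp (∑' k, ε k + 1) * (θ * σ K₀ + (∑' k, δ (k + j))) *
      (1 / θ + 2 * ((F.L : ℝ) ^ j / γ) * (Fintype.card (Plaq (F.P j) 0) : ℝ)) *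
      ((Fintype.card (PBond (F.P j) 0) ^ 2 : ℕ) : ℝ) ≤ δ₀ := by
    push_cast
    have : Real.exp (∑' k, ε k + 1) * (θ * σ K₀ + (∑' k, δ (k + j))) *
        (1 / θ + 2 * ((F.L : ℝ) ^ j / γ) * (Fintype.card (Plaq (F.P j) 0) : ℝ)) * (Fintype.card (PBond (F.P j) 0) : ℝ) ^ 2 =
        Real.exp (∑' k, ε k + 1) * (θ * σ K₀) * (1 / θ + 2 * ((F.L : ℝ) ^ j / γ) * (Fintype.card (Plaq (F.P j) 0) : ℝ)) *
          (Fintype.card (PBond (F.P j) 0) : ℝ) ^ 2 +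
        Real.exp (∑' k, ε k + 1) * ((∑' k, δ (k + j)) * (1 / θ + 2 * ((F.L : ℝ) ^ j / γ) *
          (Fintype.card (Plaq (F.P j) 0) : ℝ)) * (Fintype.card (PBond (F.P j) 0) : ℝ) ^ 2) := by ring
    linarith
  have hθin : 0 < θBal F.L γ (Real.sqrt b₀) (max pm (max pW (max 1 (max (2 * pT) pS))) / 2) j :=
    Literature.MathematicalPhysics.QuantumFieldTheory.Balaban1983to89.T3MinimiserStabilityReduction.θBal_pos
      F.hL.2.le hγ hγ1 hsb₀ _ _
  obtain ⟨p1, w1, m1, c1⟩ := hρ K₀ j hjK hj₀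
  obtain ⟨p2, w2, m2, c2⟩ := hρ K' j hjK' hj₀
  have hTVj := HTV F j (Fintype.card (PBond (F.P j) 0) ^ 2) _ _ _ (η' j) hθin hτ0 hτD (hη'0 j) hjη
    (ν K₀ j) (ν K' j) (ρ K₀ j) (ρ K' j) (hν3 K₀ j) (hν3 K' j) (fun U hU => ⟨p1 U hU, p2 U hU⟩) w1 w2 (HWj j hjW)
    (fun b U V hU hV hUV => hosc b U V hU hV hUV) (Hη' K₀ j hjK) (Hη' K' j hjK')
  -- the observable pulled up to height j (v10: any measurable `g`, `|g| ≤ 1`, on unit fields)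
  have hAj : Measurable fun u : GaugeField (F.P j) 0 (Matrix.specialUnitaryGroup (Fin 2) ℂ) => g (Literature.MathematicalPhysics.QuantumFieldTheory.Balaban1983to89.T3LevelShift.unitShift F j (Averaging.iter (fun i => BlockAveraging.blockAvg (P := F.P j) (j := i) ℰp) j u)) :=
    hg.comp ((Literature.MathematicalPhysics.QuantumFieldTheory.Balaban1983to89.T3LevelShift.measurable_unitShift F j).comp
      (Literature.MathematicalPhysics.QuantumFieldTheory.Balaban1983to89.T4Continuum.measurable_iter _ (F.avgMeasurable_of_measurableE ℰp measurableE_ℰp j) j))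
  have hint := h4c F j (ν K₀ j) (ν K' j) (hν3 K₀ j) (hν3 K' j) (t / 8) (by positivity) hTVj
    (fun u => g (Literature.MathematicalPhysics.QuantumFieldTheory.Balaban1983to89.T3LevelShift.unitShift F j (Averaging.iter (fun i => BlockAveraging.blockAvg (P := F.P j) (j := i) ℰp) j u))) hAj (fun u => hgb _)
  beta_reduce at hint
  rw [integral_comp_unitA_nestedLaw F ν hν1 hν2 hg K₀ j hjK, integral_comp_unitA_nestedLaw F ν hν1 hν2 hg K' j hjK'] at hint
  rw [Real.dist_eq, abs_sub_comm]
  linarith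

/-! ## §3 The rung leaf from the rows (port of :893–:921 + the composition at the landed doors) -/

/-- **THE R3 LEAF FROM A PER-BLOCK-SIZE CAUCHY ESTIMATE** — the organ workfile's `yM3TorusSU2_of` VERBATIM (`γ₁ := 1` by the refinement trick `T3ThresholdRemoval.expectAt_refine`, exactly as
`Theses.UnitScaleTilt.closes` reaches the leaf). [cite: Balaban1987RG1, (0.11) p.253; Balaban1985UV3, (5) p.256] -/
theorem ym3TorusSU2_of_unitLawCauchy
    (hC : ∀ L : ℕ, ∃ γ₁ : ℝ, 0 < γ₁ ∧ ∀ (F : T3Family) (γ : ℝ), F.L = L → 0 < γ → γ ≤ γ₁ →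
      ∀ (g : GaugeField (F.P 0) 0 (Matrix.specialUnitaryGroup (Fin 2) ℂ) → ℝ), Measurable g → (∀ u, |g u| ≤ 1) →
        CauchySeq (fun K => ∫ u, g u ∂(F.unitLaw ℰp measurableE_ℰp γ K))) :
    Literature.MathematicalPhysics.QuantumFieldTheory.Balaban1983to89.T3YM3TorusStatement.YM3TorusSU2 := by
  refine ⟨1, one_pos, fun F γ hγ _ => ?_⟩
  obtain ⟨γ₁, hγ₁, H⟩ := hC F.L
  have hL : (1 : ℝ) < F.L := by exact_mod_cast F.hL.2
  have hL0 : (0 : ℝ) < F.L := zero_lt_one.trans hL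
  obtain ⟨n, hn⟩ := ((tendsto_pow_atTop_nhds_zero_of_lt_one (inv_nonneg.mpr hL0.le)
    (inv_lt_one_of_one_lt₀ hL)).eventually (ge_mem_nhds (div_pos hγ₁ hγ))).exists
  have hpos : 0 < γ * ((F.L : ℝ)⁻¹) ^ n := mul_pos hγ (pow_pos (inv_pos.mpr hL0) n)
  have hle : γ * ((F.L : ℝ)⁻¹) ^ n ≤ γ₁ := by
    have e := mul_le_mul_of_nonneg_left hn hγ.le
    rwa [mul_div_cancel₀ _ hγ.ne'] at e
  rw [Literature.MathematicalPhysics.QuantumFieldTheory.Balaban1983to89.T3ContinuumYM3Torus.continuumYM3Torus_iff_hasContinuumLimit_SU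
    F ℰp measurableE_ℰp hγ.le]
  intro Cs
  have hc := H (F.refine n) _ rfl hpos hle (Literature.MathematicalPhysics.QuantumFieldTheory.Balaban1983to89.T3ThresholdRemoval.coarseObs F n ℰp Cs)
    (Literature.MathematicalPhysics.QuantumFieldTheory.Balaban1983to89.T3ThresholdRemoval.measurable_coarseObs F n ℰp measurableE_ℰp Cs) (Literature.MathematicalPhysics.QuantumFieldTheory.Balaban1983to89.T3ThresholdRemoval.abs_coarseObs_le_one F n ℰp Cs)
  obtain ⟨l, hl⟩ := cauchySeq_tendsto_of_complete hc
  refine ⟨l, (tendsto_add_atTop_iff_nat n).mp ?_⟩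
  have hkey : (fun K => (F.scheme ℰp γ).expectAt (K + n) Cs) = fun K =>
      ∫ u, Literature.MathematicalPhysics.QuantumFieldTheory.Balaban1983to89.T3ThresholdRemoval.coarseObs F n ℰp Cs u ∂(F.refine n).unitLaw ℰp measurableE_ℰp (γ * ((F.L : ℝ)⁻¹) ^ n) K :=
    funext fun K => Literature.MathematicalPhysics.QuantumFieldTheory.Balaban1983to89.T3ThresholdRemoval.expectAt_refine F n ℰp measurableE_ℰp hγ.le K Cs
  rw [hkey]
  exact hl

/-- ★★★ **R3 PATH B AS A `Theorems/` THEOREM OVER THE ORGAN ROWS WITH THE SEED DISPLAYED AS ONE ROW**: the rung leaf `T3YM3TorusStatement.YM3TorusSU2` from S1a (text VERBATIM), the crux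
`FirstExitWindow.FirstExitWindowTailL` (stmt-QuantumFields-26243, BY NAME, through ✓`RunWindowTailsDoor.runWindowTailsL_of_firstExitWindowTailL`), the seed S2 `RunPairSeed` (text v15 VERBATIM;
px21 g12's P-B1 `runPairSeed_of_tables` unfolds it into S2α′ ∧ S2β — follow-up file), and O1 (`RunPairOrgan.OneStepContractionRun`, through ✓`finiteChain_sup`); S4a–c enter by their landed
stubs ✓`stub_innerWindowChains` ∕ ✓`stub_windowTV` ∕ ✓`stub_integralOfTV`.  CONDITIONAL on four OPEN rows {S1a, 26243, S2, O1}; proves none of them.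
[cite: Balaban1985UV3, (5) p.256, (7) p.257, (41) p.266, (71) p.273; Balaban1987RG1, (0.11) p.253] -/
theorem ym3TorusSU2_of_runPairOrganRowsSeed
    (hS1a : ∀ (L : ℕ), ∃ pm : ℝ, 0 < pm ∧ ∀ (p₀ : ℝ), pm ≤ p₀ → ∃ b₀ : ℝ, 0 < b₀ ∧ ∃ γ₁ : ℝ, 0 < γ₁ ∧ ∀ (F : T3Family) (γ : ℝ), F.L = L → 0 < γ → γ ≤ γ₁ →
      ∃ (j₀ : ℕ) (prm : ℕ → ClassParams), AdmissibleClassParams F γ b₀ p₀ prm ∧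
      ∀ (ν : ℕ → (j : ℕ) → Measure (GaugeField (F.P j) 0 (Matrix.specialUnitaryGroup (Fin 2) ℂ))),
      (∀ K, ν K K = T4GenFunBounds.gibbsMeasure (F.P K) ((F.scheme ℰp γ).β K)) →
      (∀ K j, j < K → ν K j = Measure.map (descend F ℰp j) (ν K (j + 1))) →
      ∃ ρ : ℕ → (j : ℕ) → GaugeField (F.P j) 0 (Matrix.specialUnitaryGroup (Fin 2) ℂ) → ℝ,
      ∀ (K j : ℕ) (hjK : j ≤ K), j₀ ≤ j →
      (∀ U, PlaqSmall (θBal F.L γ b₀ p₀ j) U → 0 < ρ K j U) ∧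
      ν K j = (fieldMeasure _ _ _).withDensity (fun U => ENNReal.ofReal (ρ K j U)) ∧
      MemOfRun F ℰp hjK (prm j) (ρ K j) ∧
      ContinuousOn (ρ K j) {U | PlaqSmall (θBal F.L γ b₀ p₀ j) U})
    (h26243 : Summit.QuantumFields.YangMills.Theses.FirstExitWindow.FirstExitWindowTailL)
    (hS2 : ∀ (L : ℕ), ∃ pS : ℝ, ∀ (b₀ p₀ : ℝ), 0 < b₀ → pS ≤ p₀ → 0 < p₀ → ∃ γ₁ : ℝ, 0 < γ₁ ∧ ∃ κ : ℝ, 0 < κ ∧ ∀ (F : T3Family) (γ : ℝ), F.L = L → 0 < γ → γ ≤ γ₁ →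
      ∃ (J : ℕ → ℕ) (σ : ℕ → ℝ), (∀ K, 1 ≤ K → J K < K) ∧ (∀ K, J K ≤ K) ∧ Tendsto J atTop atTop ∧ (∀ K, 0 ≤ σ K) ∧
      Tendsto σ atTop (𝓝 0) ∧
      Tendsto (fun K => (J K : ℝ) * σ K) atTop (𝓝 0) ∧
      ∀ (ν : ℕ → (j : ℕ) → Measure (GaugeField (F.P j) 0 (Matrix.specialUnitaryGroup (Fin 2) ℂ))),
      (∀ K, ν K K = T4GenFunBounds.gibbsMeasure (F.P K) ((F.scheme ℰp γ).β K)) →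
      (∀ K j, j < K → ν K j = Measure.map (descend F ℰp j) (ν K (j + 1))) →
      ∀ (K K' : ℕ), K ≤ K' → ∀ (ρ₁ ρ₂ : GaugeField (F.P (J K)) 0 (Matrix.specialUnitaryGroup (Fin 2) ℂ) → ℝ),
      (∀ U, PlaqSmall (θBal F.L γ b₀ p₀ (J K)) U → 0 < ρ₁ U ∧ 0 < ρ₂ U) →
      ν K (J K) = (fieldMeasure _ _ _).withDensity (fun U => ENNReal.ofReal (ρ₁ U)) →
      ν K' (J K) = (fieldMeasure _ _ _).withDensity (fun U => ENNReal.ofReal (ρ₂ U)) →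
      ContinuousOn ρ₁ {U | PlaqSmall (θBal F.L γ b₀ p₀ (J K)) U} →
      ContinuousOn ρ₂ {U | PlaqSmall (θBal F.L γ b₀ p₀ (J K)) U} →
      ∀ (b b' : PBond (F.P (J K)) 0) (U V W Z : GaugeField (F.P (J K)) 0 (Matrix.specialUnitaryGroup (Fin 2) ℂ)),
      PlaqSmall (θBal F.L γ b₀ p₀ (J K)) U → PlaqSmall (θBal F.L γ b₀ p₀ (J K)) V →
      PlaqSmall (θBal F.L γ b₀ p₀ (J K)) W → PlaqSmall (θBal F.L γ b₀ p₀ (J K)) Z →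
      (∀ e, e ≠ b → U e = V e) → (∀ e, e ≠ b' → U e = W e) → (∀ e, e ≠ b' → V e = Z e) → (∀ e, e ≠ b → W e = Z e) →
      |(Real.log (ρ₁ U) - Real.log (ρ₂ U)) - (Real.log (ρ₁ V) - Real.log (ρ₂ V)) -
      ((Real.log (ρ₁ W) - Real.log (ρ₂ W)) - (Real.log (ρ₁ Z) - Real.log (ρ₂ Z)))|
      ≤ σ K * Real.exp (-(κ * (b.src.tdist b'.src : ℝ))))
    (hO1 : OneStepContractionRun) :
    Literature.MathematicalPhysics.QuantumFieldTheory.Balaban1983to89.T3YM3TorusStatement.YM3TorusSU2 :=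
  ym3TorusSU2_of_unitLawCauchy (unitLawCauchy_perL_of_rows hS1a (runWindowTailsL_of_firstExitWindowTailL h26243) hS2
    (finiteChain_sup hO1) stub_innerWindowChains stub_windowTV stub_integralOfTV)


end Summit.QuantumFields.YangMills.Theorems.FluctuationComparisonRegPrIntL.RunPairOrganRung

end
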